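/-
Origin: written from primary sources — Y. Liu, *Fourier–Jacobi cycles and arithmetic relative trace formula*, Camb. J. Math. 9
(2021), proof of Thm. 4.15 (arXiv:2102.11518 `FJcycle.tex` l. 2193–2210: «the map … induced by the inclusion `G⋆ ↪ G` sends
`V(μ,e)` to `V⋆(μ,e)`»); S. Kudla, *Seesaw dual reductive pairs* (1984) §1; P. Fleig et al., *Eisenstein Series and Automorphic
Representations* (2018) §12.3 (12.37). Adapted: no. This is the FORMS-LEVEL packaging (cell hodgecm-mathlib (T2) S2 chain, piece
(g2ℓ), pen A-plan1 14:00:23Z (2)) of A-p08's lift-slice identity (`UnitaryDualPairSeesawThetaLiftLeft`) through A-p03's seam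
(`ThetaClassRestriction.apply_restrictHom_thetaForm`). Kernel only; no records; no named facts; no definitions.
-/
import Literature.NumberTheory.GelbartRogawski1991.UnitaryDualPairSeesawThetaLiftLeft
import Literature.NumberTheory.Automorphic.ThetaClassRestriction
import HarnessLib

-- buildfix G11b-3 recipe: elaborate sequentially so the trailing `attribute [implicit_reducible]` block is in force at `.olean` export.
set_option Elab.async false

/-!
# [Liu 2021] «`V(μ,e)|_{G⋆} ⊆ V⋆(μ,e) ⊗ C([U(V⋆^⊥)])`» for theta ONE-FORMS: every `U(V⋆^⊥)`-slice of a restricted theta form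
# lies in the span of the small pair's theta lifts

Topic `NumberTheory/GelbartRogawski1991`. Two layers.

## §1 Generic (namespace `Literature.NumberTheory.Weil1964.ThetaKernelDatum`)
For a theta-kernel datum `M` (pair `(GU, G)`), a restriction homomorphism `J : GU₁ × GU₂ →* GU`, a weight `f`, a point `g₂ : GU₂`
and ANY submodule `S ≤ (GU₁ → ℂ)` of «admissible slices»: the slice map `Φ ↦ (g₁ ↦ Θ̃_Φ(f)(J(g₁,g₂)))` is LINEAR
(`thetaLiftFunₗ`), so it carries `Submodule.span ℂ 𝒢` into `S` as soon as it carries the generators `𝒢` into `S`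
(`sliceFun_thetaLiftFun_mem_of_mem_span`); composed with the seam `ℓ ((thetaForm j f)|_J (x)) = Θ̃_{j(ι ℓ)}(f)(J x)`
(★ `apply_restrictHom_thetaForm`) this gives the FORMS statement `slice_restrictHom_thetaForm_mem_of_mem_span`: for a theta
form `thetaForm j f` of `M` restricted along `J`, every functional `ℓ` and every `g₂`, the slice `g₁ ↦ ℓ(F(g₁,g₂))` lies in `S`
whenever the test vector `j (ι ℓ)` lies in `span 𝒢`.
## §2 Concrete (namespace `Literature.NumberTheory.GelbartRogawski1991.UnitaryDualPair`)
`𝒢` = the pure tensors `R_{e_V}(R_{e₁}⁻¹Φ₁ ⊠_{e_Σ} R_{e₂}⁻¹Φ₂)` of the V-side see-saw `U(J₁) × U(J₂) ↪ U(J₁ ⊕ᶠ J₂)` against `U(J_W)`,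
`S g₂` = `Submodule.span ℂ {Θ̃¹_{Ψ}(f′) | Ψ ∈ 𝒮(𝔸^{n₁}), f′ ∈ C([U(J_W)])}` (the FUNCTION-LEVEL avatar of Liu's `V⋆(μ,e) ⊗ C([U(V⋆^⊥)])`,
sliced at `g₂`), and the generator statement is A-p08's ★ `thetaLiftFun_blockDiag_sumTensor` (the slice of a pure tensor IS one small
theta lift, with the `g₂`-twisted weight `f · θ²_{Φ₂}(g₂⁻¹Γ₂, ·)`): `sliceFun_thetaLiftFun_blockDiag_mem_span` (functions) and
**`slice_restrictHom_thetaForm_blockDiag_mem_span`** (forms).  The span hypothesis on the test vector (`hΦ` / `hΨ`: «finitely many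
pairs `(φ⋆,i, φ⋆,i^⊥)`», l. 2199–2203) is discharged at the cell's Fock frames by the S2d leaves (`AdelicSchwartzBruhatDirectSumSpan`,
`ArchFollandGaussianSplit`, `ArchFollandHermiteSplit`, `ArchFollandHermiteReindex`); the see-saw character hypothesis `hχ` by
★ `mpSeesawCharLeft_eq_one_of_rational` / S2c.  The `K`-type dress of the slice-wise target is DEFERRED to the rank-2 receptacle edition
(LIU415-SPEC §7, T2-R1..R3): no Submodule is defined here.

References: [Liu2021] proof of Thm. 4.15 l. 2193–2210; [Kudla1984] §1; [FleigEtAl2018] §12.3 (12.37).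
-/

set_option autoImplicit false

noncomputable section

open _root_.MeasureTheory Function Module NumberField
open scoped Matrix Kronecker
open Literature.NumberTheory.Automorphic Literature.NumberTheory.Automorphic.WeightForms

namespace Literature.NumberTheory.Weil1964.ThetaKernelDatum

/-! ## §1 Generic: the slice map is linear, so spans go to spans -/

section Generic

-- `{instSX : TopologicalSpace SX}` is an IMPLICIT (unification-filled) binder on purpose: at the cell's concrete data `SX` is
-- the type synonym `WeilThetaDatum.ThetaTop` with its Θ-initial topology, which instance SYNTHESIS at `SX := 𝒮(𝔸^n)` would
-- not reproduce (cf. the `@`-workaround in `UnitaryDualPairThetaLiftCharacterCovariance`); the algebraic instances are the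
-- ordinary ones of the underlying Schwartz–Bruhat module.
variable {Mp : Type*} {SX : Type*} [TopologicalSpace Mp] [Group Mp] {instSX : TopologicalSpace SX}
variable {GU : Type*} [Group GU] [TopologicalSpace GU] [IsTopologicalGroup GU] {ΓU : Subgroup GU}
variable {G : Type*} [Group G] [TopologicalSpace G] [IsTopologicalGroup G] {Γ : Subgroup G}
variable (M : ThetaKernelDatum Mp SX GU ΓU G Γ)
variable [AddCommGroup SX] [Module ℂ SX]
variable [CompactSpace (GU ⧸ ΓU)] [CompactSpace (G ⧸ Γ)] [MeasurableSpace (G ⧸ Γ)] [BorelSpace (G ⧸ Γ)]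
  (μ : Measure (G ⧸ Γ)) [IsFiniteMeasure μ]
variable {GU₁ GU₂ : Type*} [Group GU₁] [Group GU₂] (J : GU₁ × GU₂ →* GU)

/-- **Spans go to admissible slices**: if every generator `b ∈ 𝒢` has its `g₂`-slice `g₁ ↦ Θ̃_b(f)(J(g₁,g₂))` in a submodule `S`
of functions on `GU₁`, then so has every `Φ ∈ span 𝒢` — the slice map is the linear map
`funLeft (g₁ ↦ J(g₁,g₂)) ∘ thetaLiftFunₗ`. [cite: Liu2021, proof of Thm. 4.15 (FJcycle.tex l. 2199–2210)] -/
theorem sliceFun_thetaLiftFun_mem_of_mem_span (hlin : M.W.ThetaLinear) (f : C(G ⧸ Γ, ℂ)) (g₂ : GU₂) {𝒢 : Set SX} {S : Submodule ℂ (GU₁ → ℂ)}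
    (hgen : ∀ b ∈ 𝒢, (fun g₁ : GU₁ => M.thetaLiftFun μ b f (J (g₁, g₂))) ∈ S) {Φ : SX}
    (hΦ : Φ ∈ Submodule.span ℂ 𝒢) :
    (fun g₁ : GU₁ => M.thetaLiftFun μ Φ f (J (g₁, g₂))) ∈ S := by
  have hle : Submodule.span ℂ 𝒢 ≤
      S.comap ((LinearMap.funLeft ℂ ℂ fun g₁ : GU₁ => J (g₁, g₂)).comp (M.thetaLiftFunₗ μ hlin f)) :=
    Submodule.span_le.2 fun b hb => hgen b hb
  exact hle hΦ

variable {Kc : Type*} [Group Kc] (κ : Kc →* GU)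
variable {E : Type*} [AddCommGroup E] [Module ℂ E] {σ : Representation ℂ Kc E}
variable (j : E →ₗ[ℂ] SX) (hj : M.IsThetaEquivariant κ σ j)
variable {W : Type*} [AddCommGroup W] [Module ℂ W] [IsReflexive ℂ W] {τ : Representation ℂ Kc W}
variable (ι : Dual ℂ W →ₗ[ℂ] E) (hι : ∀ (k : Kc) (ℓ : Dual ℂ W), ι (τ.dual k ℓ) = σ k (ι ℓ))
variable {Kcs : Type*} [Group Kcs] {ΓUs : Subgroup (GU₁ × GU₂)} {κs : Kcs →* GU₁ × GU₂} {τs : Representation ℂ Kcs W}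
  (hΓJ : IsLevelCorrected ΓU κ τ J ΓUs) {ηJ : Kcs →* Kc} (hηJ : IsWeightMatched κ τ J κs τs ηJ)

/-- **Forms version**: for the theta form `thetaForm j f` of `M` restricted along `J : GU₁ × GU₂ →* GU`, every functional `ℓ`
and every `g₂`, the slice `g₁ ↦ ℓ (F (g₁, g₂))` lies in the submodule `S` of admissible slices as soon as the generators do and
the test vector `j (ι ℓ)` lies in `span 𝒢` (seam ★ `apply_restrictHom_thetaForm`: the slice IS `g₁ ↦ Θ̃_{j(ι ℓ)}(f)(J(g₁,g₂))`).
[cite: Liu2021, proof of Thm. 4.15 (FJcycle.tex l. 2199–2210)] -/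
theorem slice_restrictHom_thetaForm_mem_of_mem_span (hlin : M.W.ThetaLinear) (f : C(G ⧸ Γ, ℂ)) (g₂ : GU₂) (ℓ : Dual ℂ W) {𝒢 : Set SX}
    {S : Submodule ℂ (GU₁ → ℂ)} (hgen : ∀ b ∈ 𝒢, (fun g₁ : GU₁ => M.thetaLiftFun μ b f (J (g₁, g₂))) ∈ S)
    (hΨ : j (ι ℓ) ∈ Submodule.span ℂ 𝒢) :
    (fun g₁ : GU₁ => ℓ ((restrictHom J hΓJ hηJ (M.thetaForm μ hlin κ j hj ι hι f) : GU₁ × GU₂ → W) (g₁, g₂))) ∈ S := by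
  have hfun : (fun g₁ : GU₁ => ℓ ((restrictHom J hΓJ hηJ (M.thetaForm μ hlin κ j hj ι hι f) : GU₁ × GU₂ → W) (g₁, g₂))) =
      fun g₁ : GU₁ => M.thetaLiftFun μ (j (ι ℓ)) f (J (g₁, g₂)) :=
    funext fun g₁ => M.apply_restrictHom_thetaForm μ hlin κ j hj ι hι J hΓJ hηJ f (g₁, g₂) ℓ
  rw [hfun]
  exact M.sliceFun_thetaLiftFun_mem_of_mem_span μ J hlin f g₂ hgen hΨ

end Generic

end Literature.NumberTheory.Weil1964.ThetaKernelDatum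

/-! ## §2 Concrete: the V-side see-saw of the unitary dual pairs -/

namespace Literature.NumberTheory.GelbartRogawski1991

namespace UnitaryDualPair

open Literature.NumberTheory.Automorphic.UnitaryGroup Literature.NumberTheory.Weil1964
open Literature.RepresentationTheory.HeisenbergGroup

section Concrete

variable (F E : Type) [Field F] [NumberField F] [Field E] [NumberField E] [Algebra F E]
variable (c : E ≃ₐ[F] E) (N₁ N₂ M : ℕ) {n n₁ n₂ : ℕ}
  (eV : Fin (N₁ + N₂) × Fin M ≃ Fin n) (e₁ : Fin N₁ × Fin M ≃ Fin n₁) (e₂ : Fin N₂ × Fin M ≃ Fin n₂)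
variable (J₁ : Matrix (Fin N₁) (Fin N₁) E) (J₂ : Matrix (Fin N₂) (Fin N₂) E) (JW : Matrix (Fin M) (Fin M) E)
variable {T₁ : Matrix (Fin N₁) (Fin N₁) F} {T₂ : Matrix (Fin N₂) (Fin N₂) F} {TW : Matrix (Fin M) (Fin M) F}
variable [Algebra.IsQuadraticExtension F E] {δ : E} (hcδ : c δ = -δ) (hδ : δ ≠ 0) {d : F}
  (hd : δ * δ = algebraMap F E d) (h₁ : T₁.IsSymm) (h₂ : T₂.IsSymm) (hW : TW.IsSymm) (h₁d : IsUnit T₁.det)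
  (h₂d : IsUnit T₂.det) (hWd : IsUnit TW.det) (hVd : IsUnit (finSum N₁ N₂ T₁ T₂).det)
  (hJ₁ : J₁ = T₁.map (algebraMap F E)) (hJ₂ : J₂ = T₂.map (algebraMap F E)) (hJW : JW = TW.map (algebraMap F E))
variable {s : adelicPair F E c (N₁ + N₂) M (finSum N₁ N₂ J₁ J₂) JW →*
    adelicMpCont F (Fin n) (adelicGram F eV (finSum N₁ N₂ T₁ T₂) TW)}
  {s₁ : adelicPair F E c N₁ M J₁ JW →* adelicMpCont F (Fin n₁) (adelicGram F e₁ T₁ TW)}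
  {s₂ : adelicPair F E c N₂ M J₂ JW →* adelicMpCont F (Fin n₂) (adelicGram F e₂ T₂ TW)}
variable [LocallyCompactSpace (adelic F E c (N₁ + N₂) (finSum N₁ N₂ J₁ J₂))] [LocallyCompactSpace (adelic F E c N₁ J₁)]
  [LocallyCompactSpace (adelic F E c N₂ J₂)] [LocallyCompactSpace (adelic F E c M JW)]
variable
  (hs : (splittingDatum F E c (N₁ + N₂) M eV (finSum N₁ N₂ J₁ J₂) JW hcδ hδ hd (isSymm_finSum h₁ h₂) hW hVd hWd
    (finSum_eq_map_finSum F E N₁ N₂ J₁ J₂ hJ₁ hJ₂) hJW).IsCompatible s)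
  (hs₁ : (splittingDatum F E c N₁ M e₁ J₁ JW hcδ hδ hd h₁ hW h₁d hWd hJ₁ hJW).IsCompatible s₁)
  (hs₂ : (splittingDatum F E c N₂ M e₂ J₂ JW hcδ hδ hd h₂ hW h₂d hWd hJ₂ hJW).IsCompatible s₂)
  (hρ : HasThetaMajorants fun (p : adelic F E c (N₁ + N₂) (finSum N₁ N₂ J₁ J₂) × adelic F E c M JW)
    (Φ : piSchwartzBruhat F (Fin n)) => pairRep F E c (N₁ + N₂) M eV (finSum N₁ N₂ J₁ J₂) JW s p Φ)
  (SK : Set (piSchwartzBruhat F (Fin n)))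
  (hSK : ∀ (h : adelic F E c M JW) (Φ : piSchwartzBruhat F (Fin n)), Φ ∈ SK →
    pairRep F E c (N₁ + N₂) M eV (finSum N₁ N₂ J₁ J₂) JW s (1, h) Φ ∈ SK)
  (hρ₁ : HasThetaMajorants fun (p : adelic F E c N₁ J₁ × adelic F E c M JW) (Φ : piSchwartzBruhat F (Fin n₁)) =>
    pairRep F E c N₁ M e₁ J₁ JW s₁ p Φ)
  (SK₁ : Set (piSchwartzBruhat F (Fin n₁)))
  (hSK₁ : ∀ (h : adelic F E c M JW) (Φ : piSchwartzBruhat F (Fin n₁)), Φ ∈ SK₁ → pairRep F E c N₁ M e₁ J₁ JW s₁ (1, h) Φ ∈ SK₁)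
  (hρ₂ : HasThetaMajorants fun (p : adelic F E c N₂ J₂ × adelic F E c M JW) (Φ : piSchwartzBruhat F (Fin n₂)) =>
    pairRep F E c N₂ M e₂ J₂ JW s₂ p Φ)
  (SK₂ : Set (piSchwartzBruhat F (Fin n₂)))
  (hSK₂ : ∀ (h : adelic F E c M JW) (Φ : piSchwartzBruhat F (Fin n₂)), Φ ∈ SK₂ → pairRep F E c N₂ M e₂ J₂ JW s₂ (1, h) Φ ∈ SK₂)
variable [CompactSpace (adelic F E c (N₁ + N₂) (finSum N₁ N₂ J₁ J₂) ⧸ (toAdelic F E c (N₁ + N₂) (finSum N₁ N₂ J₁ J₂)).range)]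
  [CompactSpace (adelic F E c N₁ J₁ ⧸ (toAdelic F E c N₁ J₁).range)]
  [CompactSpace (adelic F E c M JW ⧸ (toAdelic F E c M JW).range)]
  [MeasurableSpace (adelic F E c M JW ⧸ (toAdelic F E c M JW).range)]
  [BorelSpace (adelic F E c M JW ⧸ (toAdelic F E c M JW).range)]
  (μ : Measure (adelic F E c M JW ⧸ (toAdelic F E c M JW).range)) [IsFiniteMeasure μ]


omit [LocallyCompactSpace (adelic F E c N₁ J₁)] [LocallyCompactSpace (adelic F E c N₂ J₂)]
  [CompactSpace (adelic F E c (N₁ + N₂) (finSum N₁ N₂ J₁ J₂) ⧸ (toAdelic F E c (N₁ + N₂) (finSum N₁ N₂ J₁ J₂)).range)]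
  [CompactSpace (adelic F E c N₁ J₁ ⧸ (toAdelic F E c N₁ J₁).range)]
  [CompactSpace (adelic F E c M JW ⧸ (toAdelic F E c M JW).range)]
  [MeasurableSpace (adelic F E c M JW ⧸ (toAdelic F E c M JW).range)]
  [BorelSpace (adelic F E c M JW ⧸ (toAdelic F E c M JW).range)] [IsFiniteMeasure μ] in
/-- **The theta-kernel datum of the big pair is theta-linear** (`Φ ↦ Θ_Φ(S)` is `Θ_𝔸 ∘ ω_ψ(s_pair S)`, a composite of linear maps) —
the standing hypothesis `hlin` of `ThetaWeightForms` / `ThetaClassRestriction` discharged for `UnitaryDualPair.thetaKernelDatum`.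
[cite: Weil1964, Chap. III n° 41 Thm 6 p. 193] -/
theorem thetaKernelDatum_finSum_thetaLinear :
    WeilThetaDatum.ThetaLinear (SX := piSchwartzBruhat F (Fin n))
      (thetaKernelDatum F E c (N₁ + N₂) M eV (finSum N₁ N₂ J₁ J₂) JW hcδ hδ hd (isSymm_finSum h₁ h₂) hW hVd hWd
          (finSum_eq_map_finSum F E N₁ N₂ J₁ J₂ hJ₁ hJ₂) hJW s hs hρ SK hSK).W :=
  fun S => ((thetaDistLM F (Fin n)).comp (pairRep F E c (N₁ + N₂) M eV (finSum N₁ N₂ J₁ J₂) JW s S)).isLinear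

include hρ₂ SK₂ hSK₂ in
/-- **[Liu2021] «theta functions restrict to theta functions», FUNCTION LEVEL on the span of pure tensors**: for every weight
`f ∈ C([U(J_W)])`, every `g₂ ∈ U(J₂)(𝔸)` and every test vector `Φ` in the `ℂ`-span of the pure tensors
`R_{e_V}(R_{e₁}⁻¹Φ₁ ⊠_{e_Σ} R_{e₂}⁻¹Φ₂)`, the slice `g₁ ↦ Θ̃_Φ(f)(g₁ ⊕ᶠ g₂)` of the big theta lift lies in the `ℂ`-span of the small theta
lifts `Θ̃¹_Ψ(f′)` (`Ψ ∈ 𝒮(𝔸_F^{n₁})`, `f′ ∈ C([U(J_W)])`) — generator case = ★ `thetaLiftFun_blockDiag_sumTensor` (one small lift with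
the twisted weight `f · θ²_{Φ₂}(g₂⁻¹Γ₂, ·)`), then §1.  [cite: Liu2021, proof of Thm. 4.15 (FJcycle.tex l. 2199–2210)]
[cite: Kudla1984, §1] -/
theorem sliceFun_thetaLiftFun_blockDiag_mem_span
    (hχ : ∀ p, mpSeesawCharLeft F E c N₁ N₂ M eV e₁ e₂ J₁ J₂ JW hcδ hδ hd h₁ h₂ hW h₁d h₂d hWd hVd hJ₁ hJ₂ hJW hs hs₁ hs₂ p = 1)
    (f : C(adelic F E c M JW ⧸ (toAdelic F E c M JW).range, ℂ)) (g₂ : adelic F E c N₂ J₂)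
    {Φ : piSchwartzBruhat F (Fin n)}
    (hΦ : Φ ∈ Submodule.span ℂ
      (Set.range fun ΦΦ : piSchwartzBruhat F (Fin n₁) × piSchwartzBruhat F (Fin n₂) =>
          piSBReindex F eV (sumTensor F ((finSumFinEquiv.prodCongr (Equiv.refl (Fin M))).symm.trans
            (Equiv.sumProdDistrib (Fin N₁) (Fin N₂) (Fin M))) ((piSBReindex F e₁).symm ΦΦ.1) ((piSBReindex F e₂).symm ΦΦ.2)))) :
    (fun g₁ : adelic F E c N₁ J₁ =>
        (thetaKernelDatum F E c (N₁ + N₂) M eV (finSum N₁ N₂ J₁ J₂) JW hcδ hδ hd (isSymm_finSum h₁ h₂) hW hVd hWd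
          (finSum_eq_map_finSum F E N₁ N₂ J₁ J₂ hJ₁ hJ₂) hJW s hs hρ SK hSK).thetaLiftFun μ Φ f
          (adelicBlockDiag F E c N₁ N₂ J₁ J₂ (g₁, g₂))) ∈
      (Submodule.span ℂ (Set.range fun Ψf : piSchwartzBruhat F (Fin n₁) × C(adelic F E c M JW ⧸ (toAdelic F E c M JW).range, ℂ) =>
          (thetaKernelDatum F E c N₁ M e₁ J₁ JW hcδ hδ hd h₁ hW h₁d hWd hJ₁ hJW s₁ hs₁ hρ₁ SK₁ hSK₁).thetaLiftFun μ Ψf.1 Ψf.2)) := by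
  refine ThetaKernelDatum.sliceFun_thetaLiftFun_mem_of_mem_span (SX := piSchwartzBruhat F (Fin n))
    (thetaKernelDatum F E c (N₁ + N₂) M eV (finSum N₁ N₂ J₁ J₂) JW hcδ hδ hd (isSymm_finSum h₁ h₂) hW hVd hWd
      (finSum_eq_map_finSum F E N₁ N₂ J₁ J₂ hJ₁ hJ₂) hJW s hs hρ SK hSK) μ (adelicBlockDiag F E c N₁ N₂ J₁ J₂)
    (thetaKernelDatum_finSum_thetaLinear F E c N₁ N₂ M eV J₁ J₂ JW hcδ hδ hd h₁ h₂ hW hWd hVd hJ₁ hJ₂ hJW hs hρ SK hSK)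
    f g₂ ?_ hΦ
  rintro _ ⟨ΦΦ, rfl⟩
  refine Submodule.subset_span ⟨(ΦΦ.1, f * ((thetaKernelDatum F E c N₂ M e₂ J₂ JW hcδ hδ hd h₂ hW h₂d hWd hJ₂ hJW s₂ hs₂ hρ₂ SK₂ hSK₂).thetaKer ΦΦ.2).curry
    (QuotientGroup.mk g₂⁻¹)), funext fun g₁ => ?_⟩
  exact (thetaLiftFun_blockDiag_sumTensor F E c N₁ N₂ M eV e₁ e₂ J₁ J₂ JW hcδ hδ hd h₁ h₂ hW h₁d h₂d hWd hVd hJ₁ hJ₂ hJW hs hs₁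
    hs₂ hρ SK hSK hρ₁ SK₁ hSK₁ hρ₂ SK₂ hSK₂ μ hχ ΦΦ.1 ΦΦ.2 f g₁ g₂).symm


/- NOTE. The concrete FORMS instance (the theta form of the big pair restricted along `adelicBlockDiag`, its `g₂`-slices in the span
of small theta lifts) is `ThetaKernelDatum.slice_restrictHom_thetaForm_mem_of_mem_span` (§1) applied to the big datum with
`hgen` := the generator case proved inside `sliceFun_thetaLiftFun_blockDiag_mem_span`; it is instantiated at the consumer's `K`-type
data `(κ, j, ι, hΓJ, hηJ)` (rank-2 receptacle edition, LIU415-SPEC §7) — stating it here would only re-bind those seven abstract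
hypotheses (and the `Module ℂ` instance of the `ThetaTop` synonym must be supplied by unification there, as in §1). -/

end Concrete

end UnitaryDualPair

end Literature.NumberTheory.GelbartRogawski1991

end
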